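import Summits.BirchSwinnertonDyer.BirchSwinnertonDyer.Theorems.EdixhovenFibreFiveSevenStarredOptimalManinUnitFiveSevenSupersingularCellsExplicit
import Literature.NumberTheory.PAdicHodge.DeRhamSupersingularRamified
import HarnessLib

/-!
# Crux K★ `StarredOptimalManinUnitFiveSeven` (stmt-BirchSwinnertonDyer-22226), line `kato-lever`: the de Rham input on the three
# potentially SUPERSINGULAR cells is a THEOREM — K★ BY NAME ⟸ {P1, hT₂} only

Cell `pub/bsd-wall`, seat `bsd-line-edix-p4` g13 (road (R1), ring/matching/socket side; coefficient side and η-series by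
`bsd-line-edix-p1` g15–g16). The explicit-model ramified capstone `hR'` of `…SupersingularCellsExplicit` is now the Literature theorem
`Literature.NumberTheory.PAdicHodge.isDeRham_restrictedRationalTateRep_of_explicitModel` (file `PAdicHodge/DeRhamSupersingularRamified`:
Fontaine's/Colmez's two `p`-adic periods `∫ω ∈ Fil¹`, `∫η ∉ Fil¹` over the ramified Fontaine ring `A_inf(𝒪) = 𝔸_inf(F)[ϖ]` on the Tate
module of the formal group of the good supersingular `𝒪_D`-model, matched with `T_pE(F̄)`, fed to the admissibility criterion). Hence:

* **`explicitCapstone_holds`** — `hR'` VERBATIM (the hypothesis of `isDeRham_supersingularCells_of_explicitCapstone` and of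
  `starredOptimalManinUnitFiveSeven_of_sl2NeronValues_of_explicitCapstone`), DISCHARGED.

Consequently (one-line applications of the landed tool theorems of `…SupersingularCellsExplicit`, not restated here to respect the
dedup rule): the binder `hDRss` of `…CellsOfSL2NeronValues` holds —
`isDeRham_supersingularCells_of_explicitCapstone explicitCapstone_holds` — and **K★ BY NAME ⟸ {hT₂, P1} only**:
`starredOptimalManinUnitFiveSeven_of_sl2NeronValues_of_explicitCapstone hT₂ hP1 explicitCapstone_holds` with the two cite-only named
facts `hT₂ : exists_smul_range_expStarCoord_tower_iff_trace_log`, `hP1 : exists_member_sl2ZetaElement_neron_values`. The item K★ is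
NOT closed by this; Manin's conjecture and BSD are not proved by any of this.
References: [Fontaine1982FormesDifferentielles] §5; [Colmez1992PeriodesAbeliennes] §2; [Kato2004Asterisque] (8.1.3), Thm. 9.7;
[EdixhovenManin1991] Thm. 3; [SilvermanAEC2009] VII.5.5.
-/

set_option autoImplicit false
-- the Theorems namespace of a single-conjunct summit repeats the summit name by design (D-0017)
set_option linter.dupNamespace false

noncomputable section

open scoped Classical NumberField

open Polynomial WeierstrassCurve NumberField IsDedekindDomain Field ValuativeRel
  Literature.NumberTheory.EllipticCurves Literature.NumberTheory.EllipticCurves.ModularForms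
  Literature.NumberTheory.EllipticCurves.Rank1Residual Literature.NumberTheory.EllipticCurves.Kato2004
  Literature.NumberTheory.DiophantineGeometry Rat.HeightOneSpectrum
  Literature.NumberTheory.PAdicHodge Literature.NumberTheory.GaloisRepresentations
  Literature.NumberTheory.GaloisRepresentations.IsNonarchimedeanLocalField
  Summit.BirchSwinnertonDyer.Rank1Residual.Additive
  Summit.BirchSwinnertonDyer.BirchSwinnertonDyer.Theorems
  Summit.BirchSwinnertonDyer.BirchSwinnertonDyer.Theorems.StarredOptimalManinUnitFiveSevenCellsOfSL2NeronValues
  Summit.BirchSwinnertonDyer.BirchSwinnertonDyer.Theorems.StarredOptimalManinUnitFiveSevenSupersingularCellsExplicit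

namespace Summit.BirchSwinnertonDyer.BirchSwinnertonDyer.Theorems.StarredOptimalManinUnitFiveSevenSupersingularCellsDeRhamHolds

/-- **The explicit-model ramified capstone `hR'` HOLDS** (verbatim the hypothesis of `isDeRham_supersingularCells_of_explicitCapstone`):
`Literature.NumberTheory.PAdicHodge.isDeRham_restrictedRationalTateRep_of_explicitModel`. [cite: Fontaine1982FormesDifferentielles, §5]
[cite: Colmez1992PeriodesAbeliennes, §2] -/
theorem explicitCapstone_holds :
    ∀ {F : Type} [Field F] [ValuativeRel F] [TopologicalSpace F] [IsNonarchimedeanLocalField F] [CharZero F]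
      {p : ℕ} [Fact p.Prime] [Fact (¬ IsUnit (p : integerC F))] [IsAdicComplete (Ideal.span {(p : integerC F)}) (integerC F)]
      (hp : valuation F p < 1) [Algebra ℚ_[p] F] (D : EisensteinRoot F p hp) {e : ℕ}, D.poly = X ^ e - C (p : ℤ_[p]) →
      ∀ {K₀ : Type} [Field K₀] [CharZero K₀] [Algebra K₀ F] (W₀ : WeierstrassCurve K₀) [W₀.IsElliptic]
      (a b : ℤ_[p]) (r₄ r₆ t₄ t₆ : ℕ),
      (p = 5 ∧ (e = 3 ∧ r₄ = 1 ∧ r₆ = 0 ∧ t₄ = 1 ∧ t₆ = 0 ∨ e = 6 ∧ r₄ = 4 ∧ r₆ = 0 ∧ t₄ = 2 ∧ t₆ = 0) ∨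
        p = 7 ∧ e = 4 ∧ r₄ = 0 ∧ r₆ = 2 ∧ t₄ = 0 ∧ t₆ = 1) →
      3 * r₄ = e * t₄ → 2 * r₆ = e * t₆ → IsUnit (64 * a ^ 3 * (p : ℤ_[p]) ^ t₄ + 432 * b ^ 2 * (p : ℤ_[p]) ^ t₆) →
      W₀.baseChange F = (⟨0, 0, 0, AdjoinRoot.of D.poly a * AdjoinRoot.root D.poly ^ r₄,
        AdjoinRoot.of D.poly b * AdjoinRoot.root D.poly ^ r₆⟩ : WeierstrassCurve D.Coeff).map (EisensteinRoot.Coeff.toF D) →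
      GaloisRep.IsDeRham (bdRPeriodRingData (F := F) (p := p) hp) (restrictedRationalTateRep W₀ F p) :=
  fun hp _ D _ hD _ _ _ _ W₀ _ a b r₄ r₆ t₄ t₆ hcell h₄ h₆ hu hW ↦
    isDeRham_restrictedRationalTateRep_of_explicitModel hp D hD W₀ a b r₄ r₆ t₄ t₆ hcell h₄ h₆ hu hW

end Summit.BirchSwinnertonDyer.BirchSwinnertonDyer.Theorems.StarredOptimalManinUnitFiveSevenSupersingularCellsDeRhamHolds

end
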